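import Summits.ResolutionOfSingularities.ResolutionOfSingularities.Theorems.MarkedTransferCampaignW46ThreefoldsSigmaCurveSlice
import Summits.ResolutionOfSingularities.ResolutionOfSingularities.Theorems.MarkedTransferCampaignW46ThreefoldsTauTwoSliceFiniteType
import HarnessLib

/-!
# [OURS · L1 W4.6 rung (ii-τ2)] THE `τ ≥ 2` THEOREM FOR «ONE (POSSIBLY SINGULAR) CURVE + ISOLATED POINTS» — order-`μ` locus
# = an integral curve with `τ ≥ 2` at its closed points, plus finitely many isolated `τ ≥ 2` threefold points: order-reducible, PROVED

Cell res-hironaka, LADDER-RESOLUTION rung L (D-0089), slot W4.6, rung (ii) (threefold hypersurfaces); seat res-L1-s46-pv-3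
(gen 4; rev 2 = module docstring only: honest caveat added, declarations byte-identical). Host route MarkedTransfer, host item `HypersurfaceOrderReductionDimLeThree` (stmt-ResolutionOfSingularities-16156);
filed `--kind proof --supports` it `--as helper`. CONSOLIDATION of the campaign's `τ ≥ 2` slices: the singular-curve slice
(`orderReducible_of_integralCurve_two_le_tau`, p522422) made RELATIVE TO AN OPEN by restriction to the open subscheme (the new
transports: `τ` p519265, embedding dimension, coheight, orders along the open immersion), patched with the isolated-point branches
(`orderReducible_comap_of_isolated_two_le_tau`, p515229) by `OrderReducible.of_opens_finite` (p508549). OURS scheme theory over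
PROVED tree lemmas; nothing of H. Hironaka's manuscript is asserted. AI-written; AI review is weaker than expert review.

## What is proved (no definitions)

* `CampaignW46.isClosed_singleton_image_of_opens` — a point of an open `V`, closed in `V`, whose `X`-closure stays in `V`, is
  closed in `X` (plumbing).
* `CampaignW46.orderReducible_comap_of_integralCurve_two_le_tau` — the singular-curve `τ ≥ 2` slice RELATIVE TO AN OPEN `V`
  containing the curve: every point of order `μ` lies on the curve or outside `V` ⟹ `(V, J|_V, μ)` is order-reducible.
* `CampaignW46.orderReducible_of_integralCurve_and_points_two_le_tau` — **THE THEOREM**: `X` regular Noetherian, `μ ≥ 1` the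
  maximal order of `J`; the locus of order `μ` is `i(C) ∪ S` with `C` an integral (possibly singular) quasi-excellent curve of
  codimension `2` whose closed points are threefold points with `τ ≥ 2`, and `S` a finite set of closed points off `i(C)` with
  embedding dimension `3`, `τ ≥ 2` and G-ring local rings ⟹ `OrderReducible J μ`.
* `CampaignW46.orderReducible_of_integralCurve_and_points_two_le_tau_of_locallyOfFiniteType` — G-ring hypothesis discharged for
  `X` of finite type over a field; `CampaignW46.gammaFreeGlobalDimLE_integralCurve_and_points_two_le_tau_slice` — ladder binders.

HONEST VALUE — READ THE CAVEAT. Correct, and for a REGULAR curve `C` it is the closed-point form of the locus slice (p517124 /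
p524455). Beyond regular `C` its content is doubtful: at a singular point of an irreducible curve component of the top locus the
hypothesis `τ ≥ 2` cannot hold for `μ = 2` (any characteristic) nor for any `μ` in characteristic `0` or `p > μ` (derivatives of
`f ∈ P_C^(μ)` lie in `P_C^(μ−1)`, so the directrix of `in_μ f` sits inside the ≤ 1-dimensional space of linear forms of `P_C` at a
singular point); only `p ≤ μ`, `μ ≥ 3` is not excluded and no example is known to the author. So this is NOT «the campaign's most
general τ ≥ 2 statement» in substance — that is the closed-point locus slice; what is new here is structural (restriction of the
Σ-regularisation machinery to opens, patching with isolated points). Outside in any case: several curve components, `τ = 1`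
points, `μ` below the maximal order.

References: `…ThreefoldsSigmaCurveSlice.lean` (p522422), `…ThreefoldsSigmaCurveStep.lean` (p521627), `…ThreefoldsTauTwoSlice.lean`
(p515229), `…ThreefoldsTauTwoSliceFiniteType.lean` (p516287), `…GammaFreeGlobalPatchingFinite.lean` (p508549 [Piltant2013, Prop. 5.1]),
tree `HironakaTauTransport.lean` (p519265), Mathlib `IsOpenImmersion.lift`, `IsClosedImmersion.of_comp`, `coheight_eq_of_isOpenImmersion`.
[CossartPiltant2008] H. Hironaka, ms. 2017-03-23 — scope only, under adjudication, not cited as fact. [Hironaka2017]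
-/

noncomputable section

set_option linter.dupNamespace false -- mandated namespace of this single-conjunct summit

open CategoryTheory AlgebraicGeometry TopologicalSpace IsLocalRing

namespace Summit.ResolutionOfSingularities.ResolutionOfSingularities.Theorems

namespace CampaignW46

open Literature.AlgebraicGeometry.Resolution
open Scheme.IdealSheafData
open Literature.AlgebraicGeometry.Hironaka2017

universe u

variable {X : Scheme.{u}}

/-! ## §0 Plumbing: closed points of an open subscheme -/

/-- A point of an open `V ⊆ X` which is closed in `V` and whose closure in `X` stays inside `V` is closed in `X`. [folklore] -/
theorem isClosed_singleton_image_of_opens (V : X.Opens) {v : ↥V} (hv : IsClosed ({v} : Set ↥V))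
    (hcl : closure ({V.ι v} : Set X) ⊆ (V : Set X)) : IsClosed ({V.ι v} : Set X) := by
  rw [← closure_subset_iff_isClosed]
  intro z hz
  obtain ⟨w, hw⟩ : ∃ w : ↥V, V.ι w = z := by
    have hzV : z ∈ (V : Set X) := hcl hz
    exact ⟨⟨z, hzV⟩, rfl⟩
  subst hw
  have hsp : V.ι v ⤳ V.ι w := specializes_iff_mem_closure.mpr hz
  have hsp' : v ⤳ w := (V.ι.isOpenEmbedding.isInducing.specializes_iff).mp hsp
  have hw : w ∈ closure ({v} : Set ↥V) := specializes_iff_mem_closure.mp hsp'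
  rw [hv.closure_eq, Set.mem_singleton_iff] at hw
  rw [hw]
  exact Set.mem_singleton _

/-! ## §1 The singular-curve slice relative to an open -/

set_option maxHeartbeats 800000 in
-- many small transports along the open immersion `V ↪ X`
/-- **THE SINGULAR-CURVE `τ ≥ 2` SLICE RELATIVE TO AN OPEN.** `X` regular Noetherian, `J`, `μ ≥ 1` with `ord ≤ μ` everywhere;
`i : C ↪ X` a closed immersion of an integral Noetherian quasi-excellent scheme of dimension `≤ 1` INTO THE OPEN `V`, with
`i(η_C)` not closed and of coheight `> 1`, `ord = μ` along `i(C)`, the closed points of `i(C)` threefold points with `τ ≥ 2`, and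
every point of order `μ` on `i(C)` or outside `V`. Then `(V, J|_V, μ)` is order-reducible: the absolute slice (p522422) on the
open subscheme `V`, all hypotheses transported along `V ↪ X`. [cite: CossartPiltant2008, Prop. 4.4 (proof, steps 1 and 4)] -/
theorem orderReducible_comap_of_integralCurve_two_le_tau [IsNoetherian X] (hX : Scheme.IsRegular X)
    (J : X.IdealSheafData) {μ : ℕ} (hm : 1 ≤ μ) (V : X.Opens) {C : Scheme.{u}} (i : C ⟶ X) [IsClosedImmersion i]
    [IsIntegral C] [IsNoetherian C] (hCq : Scheme.IsQuasiExcellent C) (hdim : topologicalKrullDim C ≤ 1)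
    (hiV : Set.range i ⊆ (V : Set X)) (hη : ¬ IsClosed ({i (genericPoint C)} : Set X))
    (hcoh : 1 < Order.coheight (i (genericPoint C)))
    (hbad : ∀ z : X, (μ : ℕ∞) ≤ idealOrder J z → z ∈ Set.range i ∨ z ∉ (V : Set X))
    (hcurve : ∀ c : C, (μ : ℕ∞) ≤ idealOrder J (i c)) (htop : ∀ z : X, idealOrder J z ≤ μ)
    (hdim3 : ∀ z ∈ Set.range i, IsClosed ({z} : Set X) → (maximalIdeal (X.presheaf.stalk z)).spanFinrank = 3)
    (hτ : ∀ z ∈ Set.range i, IsClosed ({z} : Set X) → haveI := hX z; 2 ≤ stalkTau J z μ) :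
    OrderReducible (J.comap V.ι) μ := by
  haveI : CompactSpace (V : Scheme.{u}) := isCompact_iff_compactSpace.mp (NoetherianSpace.isCompact (V : Set X))
  -- the open subscheme is regular, with isomorphic local rings
  have hiso : ∀ v : ↥V, IsIso (V.ι.stalkMap v) := fun v =>
    ((IsOpenImmersion.iff_isIso_stalkMap (f := V.ι)).mp inferInstance).2 v
  have hXV : Scheme.IsRegular (V : Scheme.{u}) := fun v => by
    haveI : IsRegularLocalRing (X.presheaf.stalk (V.ι v)) := hX _
    haveI := hiso v
    exact IsRegularLocalRing.of_ringEquiv (asIso (V.ι.stalkMap v)).commRingCatIsoToRingEquiv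
  -- the curve factors through the open
  have hrange : Set.range i ⊆ Set.range V.ι := by rwa [Scheme.Opens.range_ι]
  obtain ⟨i', hi'⟩ : ∃ i' : C ⟶ V, i' ≫ V.ι = i :=
    ⟨IsOpenImmersion.lift V.ι i hrange, IsOpenImmersion.lift_fac V.ι i hrange⟩
  have hi'pt : ∀ c, V.ι (i' c) = i c := fun c => by rw [← Scheme.Hom.comp_apply, hi']
  haveI : IsClosedImmersion (i' ≫ V.ι) := by rw [hi']; infer_instance
  haveI : IsClosedImmersion i' := IsClosedImmersion.of_comp i' V.ι
  -- orders along the open immersion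
  have hordV : ∀ v : ↥V, idealOrder (J.comap V.ι) v = idealOrder J (V.ι v) := fun v => idealOrder_comap_of_etale V.ι J v
  -- the range of `i'`
  have hrange' : ∀ v : ↥V, v ∈ Set.range i' ↔ V.ι v ∈ Set.range i := by
    intro v
    constructor
    · rintro ⟨c, rfl⟩; exact ⟨c, (hi'pt c).symm⟩
    · rintro ⟨c, hc⟩
      refine ⟨c, V.ι.isOpenEmbedding.injective ?_⟩
      rw [hi'pt, hc]
  -- closed points of `i'(C)` are closed points of `X` on `i(C)`
  have hclosed : ∀ v : ↥V, v ∈ Set.range i' → IsClosed ({v} : Set ↥V) → IsClosed ({V.ι v} : Set X) := by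
    intro v hv hvc
    refine isClosed_singleton_image_of_opens V hvc ((closure_minimal ?_ i.isClosedEmbedding.isClosed_range).trans hiV)
    exact Set.singleton_subset_iff.mpr ((hrange' v).mp hv)
  refine orderReducible_of_integralCurve_two_le_tau hXV (J.comap V.ι) hm i' hCq hdim ?_ ?_ ?_ ?_ ?_ ?_
  · -- the generic point of the curve is not closed in `V`
    intro hcl
    apply hη
    have hall : ∀ c : C, i' c = i' (genericPoint C) := fun c =>
      Set.mem_singleton_iff.mp
        (((genericPoint_specializes c).map i'.continuous).mem_closed hcl (Set.mem_singleton _))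
    have hrg : Set.range i = {i (genericPoint C)} := by
      ext z
      simp only [Set.mem_range, Set.mem_singleton_iff]
      constructor
      · rintro ⟨c, rfl⟩; rw [← hi'pt, hall c, hi'pt]
      · rintro rfl; exact ⟨_, rfl⟩
    rw [← hrg]
    exact i.isClosedEmbedding.isClosed_range
  · -- coheight
    rw [← coheight_eq_of_isOpenImmersion (f := V.ι), hi'pt]
    exact hcoh
  · -- the locus of order `μ` in `V`
    intro v
    refine Iff.trans ?_ (hrange' v).symm
    rw [hordV]
    constructor
    · intro hv
      rcases hbad _ hv with h | h
      · exact h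
      · exact absurd v.2 h
    · rintro ⟨c, hc⟩
      rw [← hc]
      exact hcurve c
  · intro v; rw [hordV]; exact htop _
  · intro v hv hvc
    haveI := hiso v
    rw [spanFinrank_eq_of_isIso_stalkMap V.ι v]
    exact hdim3 _ ((hrange' v).mp hv) (hclosed v hv hvc)
  · intro v hv hvc
    haveI := hiso v
    haveI : IsRegularLocalRing (X.presheaf.stalk (V.ι v)) := hX _
    haveI : IsRegularLocalRing ((V : Scheme.{u}).presheaf.stalk v) := hXV v
    have h := stalkTau_eq_of_isIso_stalkMap V.ι v J (J.comap V.ι) (stalkIdeal_comap_eq_map_stalkMap V.ι J v) μ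
    rw [h]
    exact hτ _ ((hrange' v).mp hv) (hclosed v hv hvc)

/-! ## §2 One curve and finitely many isolated points -/

set_option maxHeartbeats 400000 in
-- the bookkeeping of `n + 1` patching pieces
/-- **THE `τ ≥ 2` THEOREM FOR ONE CURVE PLUS ISOLATED POINTS.** `X` regular Noetherian, `J`, `μ ≥ 1` with `ord ≤ μ` everywhere;
the locus of order `μ` is `i(C) ∪ S`: `i : C ↪ X` a closed immersion of an integral Noetherian quasi-excellent curve
(dimension `≤ 1`, generic point not closed, of coheight `> 1`), POSSIBLY SINGULAR, whose closed points are threefold points with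
`τ ≥ 2`; `S` a finite set of closed points off `i(C)` with embedding dimension `3`, `τ ≥ 2` and G-ring local rings. Then
`(X, J, μ)` is ORDER-REDUCIBLE — the pieces `(X ∖ S, i(C))` and `(X ∖ (i(C) ∪ (S ∖ {x})), {x})` patch
(`OrderReducible.of_opens_finite`). [cite: CossartPiltant2008, Prop. 4.4 (proof); Piltant2013, Prop. 5.1] -/
theorem orderReducible_of_integralCurve_and_points_two_le_tau [IsNoetherian X] (hX : Scheme.IsRegular X)
    (J : X.IdealSheafData) {μ : ℕ} (hm : 1 ≤ μ) {C : Scheme.{u}} (i : C ⟶ X) [IsClosedImmersion i] [IsIntegral C]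
    [IsNoetherian C] (hCq : Scheme.IsQuasiExcellent C) (hdim : topologicalKrullDim C ≤ 1)
    (hη : ¬ IsClosed ({i (genericPoint C)} : Set X)) (hcoh : 1 < Order.coheight (i (genericPoint C)))
    (hcurve : ∀ c : C, (μ : ℕ∞) ≤ idealOrder J (i c)) (htop : ∀ z : X, idealOrder J z ≤ μ)
    (hdim3 : ∀ z ∈ Set.range i, IsClosed ({z} : Set X) → (maximalIdeal (X.presheaf.stalk z)).spanFinrank = 3)
    (hτ : ∀ z ∈ Set.range i, IsClosed ({z} : Set X) → haveI := hX z; 2 ≤ stalkTau J z μ)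
    (S : Set X) (hS : S.Finite) (hSc : ∀ x ∈ S, IsClosed ({x} : Set X)) (hSi : Disjoint S (Set.range i))
    (hordS : ∀ x ∈ S, idealOrder J x = μ) (hdimS : ∀ x ∈ S, (maximalIdeal (X.presheaf.stalk x)).spanFinrank = 3)
    (hτS : ∀ x ∈ S, haveI := hX x; 2 ≤ stalkTau J x μ) (hG : ∀ x ∈ S, IsGRing (X.presheaf.stalk x))
    (hJ : ∀ z : X, (μ : ℕ∞) ≤ idealOrder J z → z ∈ Set.range i ∨ z ∈ S) : OrderReducible J μ := by
  classical
  obtain ⟨n, f, hf⟩ := hS.fin_embedding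
  have hfS : ∀ k, f k ∈ S := fun k => hf ▸ Set.mem_range_self k
  have hSf : ∀ x ∈ S, ∃ k, f k = x := fun x hx => by rw [← hf] at hx; exact hx
  have hYcl : IsClosed (Set.range i) := i.isClosedEmbedding.isClosed_range
  have hScl : IsClosed S := isClosed_of_finite_of_isClosed_singleton hS hSc
  have hSicl : ∀ k, IsClosed (S \ {f k}) := fun k =>
    isClosed_of_finite_of_isClosed_singleton (hS.subset Set.sdiff_subset) fun y hy => hSc y hy.1
  let V : Fin (n + 1) → X.Opens := Fin.cases ⟨Sᶜ, hScl.isOpen_compl⟩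
    fun k => ⟨(Set.range i ∪ (S \ {f k}))ᶜ, (hYcl.union (hSicl k)).isOpen_compl⟩
  let Z : Fin (n + 1) → Set X := Fin.cases (Set.range i) fun k => {f k}
  have hV0 : (V 0 : Set X) = Sᶜ := rfl
  have hVs : ∀ k : Fin n, (V k.succ : Set X) = (Set.range i ∪ (S \ {f k}))ᶜ := fun k => rfl
  have hZ0 : Z 0 = Set.range i := rfl
  have hZs : ∀ k : Fin n, Z k.succ = {f k} := fun k => rfl
  refine OrderReducible.of_opens_finite (n + 1) hX J μ V Z (fun k => ?_) (fun k => ?_) (fun k l hkl => ?_)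
    (fun x hx => ?_) (fun k => ?_)
  · refine Fin.cases ?_ (fun k => ?_) k
    · rw [hZ0]; exact hYcl
    · rw [hZs]; exact hSc _ (hfS k)
  · refine Fin.cases ?_ (fun k => ?_) k
    · rw [hZ0, hV0]
      exact Set.subset_compl_iff_disjoint_left.mpr hSi
    · rw [hZs, hVs, Set.singleton_subset_iff, Set.mem_compl_iff, Set.mem_union, not_or]
      exact ⟨fun h => Set.disjoint_left.mp hSi (hfS k) h, fun h => h.2 rfl⟩
  · revert hkl
    refine Fin.cases ?_ (fun k' => ?_) k <;> refine Fin.cases ?_ (fun l' => ?_) l <;> intro hkl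
    · exact absurd rfl hkl
    · rw [hZ0, hVs]
      exact Set.disjoint_left.mpr fun y hy hyV => hyV (Or.inl hy)
    · rw [hZs, hV0]
      exact Set.disjoint_left.mpr fun y hy hyV => hyV (by rw [Set.mem_singleton_iff.mp hy]; exact hfS k')
    · rw [hZs, hVs]
      refine Set.disjoint_left.mpr fun y hy hyV => hyV (Or.inr ⟨?_, ?_⟩)
      · rw [Set.mem_singleton_iff.mp hy]; exact hfS k'
      · rw [Set.mem_singleton_iff.mp hy, Set.mem_singleton_iff]
        exact fun h => hkl (by rw [f.injective h])
  · rcases hJ x hx with h | h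
    · exact ⟨0, by rw [hZ0]; exact h⟩
    · obtain ⟨k, rfl⟩ := hSf x h
      exact ⟨k.succ, by rw [hZs]; exact Set.mem_singleton _⟩
  · refine Fin.cases ?_ (fun k => ?_) k
    · refine orderReducible_comap_of_integralCurve_two_le_tau hX J hm (V 0) i hCq hdim ?_ hη hcoh (fun z hz => ?_)
        hcurve htop hdim3 hτ
      · rw [hV0]; exact Set.subset_compl_iff_disjoint_left.mpr hSi
      · rcases hJ z hz with h | h
        · exact Or.inl h
        · exact Or.inr (by rw [hV0]; exact fun h' => h' h)
    · refine orderReducible_comap_of_isolated_two_le_tau hX J hm (V k.succ) (f k) ?_ (hSc _ (hfS k)) (fun z hz => ?_)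
        (hordS _ (hfS k)) (hdimS _ (hfS k)) (hτS _ (hfS k)) (hG _ (hfS k))
      · change f k ∈ (V k.succ : Set X)
        rw [hVs, Set.mem_compl_iff, Set.mem_union, not_or]
        exact ⟨fun h => Set.disjoint_left.mp hSi (hfS k) h, fun h => h.2 rfl⟩
      · by_cases hzk : z = f k
        · exact Or.inl hzk
        · right
          rw [hVs, Set.mem_compl_iff, not_not]
          rcases hJ z hz with h | h
          · exact Or.inl h
          · exact Or.inr ⟨h, hzk⟩

/-! ## §3 Finite type over a field; the ladder's binders -/

/-- The «one curve + isolated points» `τ ≥ 2` theorem for `X` regular and of finite type over a field: NO G-ring hypothesis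
(Matsumura, Cor. of Thm. 32.6, tree). [cite: CossartPiltant2008, Prop. 4.4; Matsumura1987, §32] -/
theorem orderReducible_of_integralCurve_and_points_two_le_tau_of_locallyOfFiniteType {k : Type u} [Field k]
    (s : X ⟶ Spec (.of k)) [LocallyOfFiniteType s] [QuasiCompact s] (hX : Scheme.IsRegular X)
    (J : X.IdealSheafData) {μ : ℕ} (hm : 1 ≤ μ) {C : Scheme.{u}} (i : C ⟶ X) [IsClosedImmersion i] [IsIntegral C]
    [IsNoetherian C] (hCq : Scheme.IsQuasiExcellent C) (hdim : topologicalKrullDim C ≤ 1)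
    (hη : ¬ IsClosed ({i (genericPoint C)} : Set X)) (hcoh : 1 < Order.coheight (i (genericPoint C)))
    (hcurve : ∀ c : C, (μ : ℕ∞) ≤ idealOrder J (i c)) (htop : ∀ z : X, idealOrder J z ≤ μ)
    (hdim3 : ∀ z ∈ Set.range i, IsClosed ({z} : Set X) → (maximalIdeal (X.presheaf.stalk z)).spanFinrank = 3)
    (hτ : ∀ z ∈ Set.range i, IsClosed ({z} : Set X) → haveI := hX z; 2 ≤ stalkTau J z μ)
    (S : Set X) (hS : S.Finite) (hSc : ∀ x ∈ S, IsClosed ({x} : Set X)) (hSi : Disjoint S (Set.range i))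
    (hordS : ∀ x ∈ S, idealOrder J x = μ) (hdimS : ∀ x ∈ S, (maximalIdeal (X.presheaf.stalk x)).spanFinrank = 3)
    (hτS : ∀ x ∈ S, haveI := hX x; 2 ≤ stalkTau J x μ)
    (hJ : ∀ z : X, (μ : ℕ∞) ≤ idealOrder J z → z ∈ Set.range i ∨ z ∈ S) : OrderReducible J μ := by
  haveI : IsLocallyNoetherian X := LocallyOfFiniteType.isLocallyNoetherian s
  haveI : CompactSpace X := QuasiCompact.compactSpace_of_compactSpace s
  haveI : IsNoetherian X := {}
  exact orderReducible_of_integralCurve_and_points_two_le_tau hX J hm i hCq hdim hη hcoh hcurve htop hdim3 hτ S hS hSc hSi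
    hordS hdimS hτS (fun x _ => isGRing_stalk_of_polynomial Matsumura1987_32_polynomial_holds s x) hJ

/-- **THE «ONE CURVE + ISOLATED POINTS» `τ ≥ 2` SLICE OF EVERY RUNG OF THE Γ-FREE LADDER** (`GammaFreeGlobalOrderReductionDimLE
p d`, p496755), unconditionally. [cite: CossartPiltant2008, Prop. 4.4; Matsumura1987, §32] -/
theorem gammaFreeGlobalDimLE_integralCurve_and_points_two_le_tau_slice (p d : ℕ) :
    p.Prime → ∀ (k : Type u) [Field k] [CharP k p] [PerfectField k] (X : Scheme.{u}) (s : X ⟶ Spec (.of k)),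
      IsSeparated s → LocallyOfFiniteType s → QuasiCompact s → IsIntegral X → ∀ (hreg : Scheme.IsRegular X),
        topologicalKrullDim X ≤ d → ∀ (I : X.IdealSheafData), I ≠ ⊥ → IsEffectiveCartier I → ∀ (m : ℕ), 1 ≤ m →
          ∀ (C : Scheme.{u}) (i : C ⟶ X) [IsClosedImmersion i] [IsIntegral C] [IsNoetherian C],
            Scheme.IsQuasiExcellent C → topologicalKrullDim C ≤ 1 → ¬ IsClosed ({i (genericPoint C)} : Set X) →
              1 < Order.coheight (i (genericPoint C)) → (∀ c : C, (m : ℕ∞) ≤ idealOrder I (i c)) →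
              (∀ z : X, idealOrder I z ≤ m) →
                (∀ z ∈ Set.range i, IsClosed ({z} : Set X) → (maximalIdeal (X.presheaf.stalk z)).spanFinrank = 3) →
                  (∀ z ∈ Set.range i, IsClosed ({z} : Set X) → haveI := hreg z; 2 ≤ stalkTau I z m) →
            ∀ (S : Set X), S.Finite → (∀ x ∈ S, IsClosed ({x} : Set X)) → Disjoint S (Set.range i) →
              (∀ x ∈ S, idealOrder I x = m) → (∀ x ∈ S, (maximalIdeal (X.presheaf.stalk x)).spanFinrank = 3) →
                (∀ x ∈ S, haveI := hreg x; 2 ≤ stalkTau I x m) →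
                  (∀ z : X, (m : ℕ∞) ≤ idealOrder I z → z ∈ Set.range i ∨ z ∈ S) → OrderReducible I m := by
  intro _ k _ _ _ X s _ hloft hqc _ hreg _ I _ _ m hm C i _ _ _ hCq hdim hη hcoh hcurve htop hdim3 hτ S hS hSc hSi hordS hdimS
    hτS hJ
  exact orderReducible_of_integralCurve_and_points_two_le_tau_of_locallyOfFiniteType s hreg I hm i hCq hdim hη hcoh hcurve
    htop hdim3 hτ S hS hSc hSi hordS hdimS hτS hJ

end CampaignW46

end Summit.ResolutionOfSingularities.ResolutionOfSingularities.Theorems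

end
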